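import Summits.MatrixMultiplication.MatrixMultiplication.Theorems.FarEdgeDescentAnchorTax
import HarnessLib

/-!
# Far-edge descent, kernel XXXVI-B: the squaring tower is a schedule — its certificates pay the universal anchor tax

Route `FarEdgeDescent`, special leaf `FiniteSaturation` (stmt-MatrixMultiplication-23739): helper kernel,
THESES-FREE and def-free (decomp-mm lens 2 «structural dichotomy: special vs generic», gen 56).

Kernel XXXVI-A (`FarEdgeDescentAnchorTax`) proves the schedule-universal anchor tax in normalised moment
coordinates: along ANY product-and-reanchor schedule from thin bases every moment certificate `e(A) ≤ ι`
obeys `ι·(1+A)^{θ_S} ≥ c₀ > 0`.  This file instantiates it on the object the tree already has: the moment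
sequences `(r, Q, L, M, N)` of the isolated squaring tower of kernels XXXII-C/XXXV-A,B (`Q + 2L = r`,
`L' = (Q+L)² − Q²`, `r' = r²`, `M' = 2(L+Q)M`, `N' = 2(L+Q)N + 2QL·log Q`).  With `λ_j = L_j/r_j`,
`ℓ_j = log r_j`, `m_j = M_j/r_j`, `n_j = N_j/r_j` the tower is the schedule `a(j) = b(j) = j` (pure casting:
`L² + 2QL = r²(2λ − 3λ²)`, `2(L+Q) = 2r(1−λ)`, `log Q = log r + log(1−2λ)`), the base predicate holds at
`j = 0` with `Φ₀ = m₀/((3λ₀)^{1−κ}ℓ₀^κ)` and `u₀ = min((m₀+n₀)/(λ₀ℓ₀), 1 − log 3/ℓ₀)` (`r₀ ≥ 4`, `3L₀ ≤ r₀`,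
`M₀ > 0`, `N₀ ≥ 0`), and `tower_certificate_floor` follows: some `c > 0` has
`c ≤ (L_j log(r_j/L_j)/M_j)·(1 + N_j/M_j)^{θ_S}` at every stage — each line certificate of XXXV-A
`moment_certificate` lies above the power curve of exponent `θ_S` (the moment-plane shadow of the exact
ceiling of kernel XXXIII, obtained from the schedule-universal tax; it shows the schedule class of XXXVI-A is
inhabited by the tree's tower).  No tensors, no definitions.
References: Schönhage 1981 §5; Pan 1984 (LNCS 179) §16 Props. 16.2–16.5, §17 Thm. 17.1; Stothers 2010 Thm. 8.
Tags: `FiniteSaturation` (h₁) NEC · WEAKER · method ceiling (instantiation).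
-/

set_option linter.dupNamespace false

noncomputable section

namespace Summit.MatrixMultiplication.MatrixMultiplication.Theorems.FarEdgeDescentAnchorTaxTower

open Summit.MatrixMultiplication.MatrixMultiplication.Theorems.FarEdgeDescentImprovableRate
open Summit.MatrixMultiplication.MatrixMultiplication.Theorems.FarEdgeDescentMomentReadout
open Summit.MatrixMultiplication.MatrixMultiplication.Theorems.FarEdgeDescentAnchorTax

/-! ## The squaring tower as a schedule -/

/-- **THE SQUARING TOWER IS A SCHEDULE, AND ITS CERTIFICATES PAY THE TAX.**  For the moment sequences of the
isolated squaring tower (kernel XXXV-A/B: `Q + 2L = r`, `L' = (Q+L)² − Q²`, `r' = r²`, `M' = 2(L+Q)M`,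
`N' = 2(L+Q)N + 2QL log Q`, `3L₀ ≤ r₀`, `r₀ ≥ 4`, `M₀ > 0`, `N₀ ≥ 0`) there is `c > 0` with
`c ≤ (L_j log(r_j/L_j)/M_j) · (1 + N_j/M_j)^{θ_S}` for every stage: each line certificate of
`moment_certificate` lies above the power curve of exponent `θ_S` (the moment-level shadow of the exact ceiling
of kernel XXXIII, obtained here from the schedule-universal tax with `a(j) = b(j) = j`).
[cite: Pan1984, Props. 16.2–16.5, Thm. 17.1] [cite: Schonhage1981, §5] -/
theorem tower_certificate_floor (r Q L : ℕ → ℕ) (M N : ℕ → ℝ) (hsum : ∀ j, Q j + 2 * L j = r j)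
    (hQ1 : ∀ j, 1 ≤ Q j) (hL : ∀ j, L (j + 1) = (Q j + L j) ^ 2 - Q j ^ 2)
    (hr : ∀ j, r (j + 1) = r j ^ 2) (hM : ∀ j, M (j + 1) = 2 * ((L j : ℝ) + Q j) * M j)
    (hN : ∀ j, N (j + 1) = 2 * ((L j : ℝ) + Q j) * N j + 2 * (Q j : ℝ) * L j * Real.log (Q j))
    (hr0 : 4 ≤ r 0) (hL0 : 1 ≤ L 0) (hm0 : 3 * L 0 ≤ r 0) (hM0 : 0 < M 0) (hN0 : 0 ≤ N 0) :
    ∃ c : ℝ, 0 < c ∧ ∀ j, c ≤ (L j : ℝ) * Real.log ((r j : ℝ) / L j) / M j *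
      (1 + N j / M j) ^ (Real.logb 2 ((4 : ℝ) / 3) / (1 - Real.logb 2 ((4 : ℝ) / 3))) := by
  obtain ⟨hκ0, hκ1⟩ := improvableKappa_pos_lt_one
  set κ : ℝ := Real.logb 2 ((4 : ℝ) / 3) with hκ
  have h1κ : 0 < 1 - κ := by linarith
  obtain ⟨p, hp⟩ : ∃ p : ℝ, p = 1 / (1 - κ) := ⟨_, rfl⟩
  have h23 : ((2 : ℝ) / 3) ^ p = 1 / 2 := by rw [hp, hκ, conj_exponent, twoThirds_rpow_conj]
  have hθ : κ / (1 - κ) = κ * p := by rw [hp, mul_one_div]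
  -- positivity of the tower data
  have hrpos : ∀ j, (4 : ℝ) ≤ r j := by
    intro j
    induction j with
    | zero => exact_mod_cast hr0
    | succ j ih =>
      have e : (r (j + 1) : ℝ) = (r j : ℝ) ^ 2 := by rw [hr j]; push_cast; ring
      rw [e]; nlinarith
  have hQ : ∀ j, (Q j : ℝ) = r j - 2 * L j := fun j => by
    have := hsum j
    have e : ((Q j + 2 * L j : ℕ) : ℝ) = r j := by rw [this]
    push_cast at e
    linarith
  have hLj : ∀ j, (1 : ℝ) ≤ L j := one_le_legs Q L hL hL0
  have h3L : ∀ j, 3 * (L j : ℝ) ≤ r j := by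
    intro j
    induction j with
    | zero => exact_mod_cast hm0
    | succ j ih =>
      have e : (r (j + 1) : ℝ) = (r j : ℝ) ^ 2 := by rw [hr j]; push_cast; ring
      rw [e, legs_real Q L hL j, hQ j]
      nlinarith [hLj j]
  -- normalised coordinates (no definitions: plain lambda terms)
  have hl₀ : 0 < (L 0 : ℝ) / r 0 := div_pos (by linarith [hLj 0]) (by linarith [hrpos 0])
  have hℓ₀0 : Real.log 3 < Real.log (r 0 : ℝ) := Real.log_lt_log (by norm_num) (by linarith [hrpos 0])
  have hl3 : 0 < Real.log 3 := Real.log_pos (by norm_num)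
  have hℓ₀pos : 0 < Real.log (r 0 : ℝ) := lt_trans hl3 hℓ₀0
  have hm₀ : 0 < M 0 / r 0 := div_pos hM0 (by linarith [hrpos 0])
  have hn₀ : 0 ≤ N 0 / r 0 := div_nonneg hN0 (by linarith [hrpos 0])
  have hlam0 : (L 0 : ℝ) / r 0 ≤ 1 / 3 := by
    rw [div_le_iff₀ (by linarith [hrpos 0])]; linarith [h3L 0]
  have hD : 0 < (3 * ((L 0 : ℝ) / r 0)) ^ (1 - κ) * Real.log (r 0 : ℝ) ^ κ :=
    mul_pos (Real.rpow_pos_of_pos (by positivity) _) (Real.rpow_pos_of_pos hℓ₀pos _)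
  obtain ⟨Φ, hΦ⟩ : ∃ Φ : ℝ, Φ = M 0 / r 0 / ((3 * ((L 0 : ℝ) / r 0)) ^ (1 - κ) * Real.log (r 0 : ℝ) ^ κ) :=
    ⟨_, rfl⟩
  have hΦpos : 0 < Φ := by rw [hΦ]; exact div_pos hm₀ hD
  obtain ⟨u₀, hu₀⟩ : ∃ u₀ : ℝ, u₀ = min ((M 0 / r 0 + N 0 / r 0) / ((L 0 : ℝ) / r 0 * Real.log (r 0 : ℝ)))
      (1 - Real.log 3 / Real.log (r 0 : ℝ)) := ⟨_, rfl⟩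
  have hu₀pos : 0 < u₀ := by
    rw [hu₀]
    refine lt_min (div_pos (by linarith) (mul_pos hl₀ hℓ₀pos)) ?_
    rw [sub_pos, div_lt_one hℓ₀pos]; exact hℓ₀0
  have hℓ₀ : Real.log 3 ≤ (1 - u₀) * Real.log (r 0 : ℝ) := by
    have hle : u₀ ≤ 1 - Real.log 3 / Real.log (r 0 : ℝ) := by rw [hu₀]; exact min_le_right _ _
    have e : (1 - (1 - Real.log 3 / Real.log (r 0 : ℝ))) * Real.log (r 0 : ℝ) = Real.log 3 := by
      field_simp
      ring
    nlinarith
  -- normalised coordinates (local abbreviations, no definitions) and the schedule hypothesis, a(j)=b(j)=j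
  set lam : ℕ → ℝ := fun i => (L i : ℝ) / r i with hlam
  set ℓ : ℕ → ℝ := fun i => Real.log (r i : ℝ) with hℓ
  set m : ℕ → ℝ := fun i => M i / r i with hm
  set n : ℕ → ℝ := fun i => N i / r i with hn
  have H : ∀ j, ((L 0 : ℝ) / r 0 ≤ lam j ∧ lam j ≤ 1 / 3 ∧ Real.log (r 0 : ℝ) ≤ ℓ j ∧ 0 < m j ∧
      0 ≤ n j ∧ m j ≤ Φ * ((3 * lam j) ^ (1 - κ) * ℓ j ^ κ) ∧ u₀ * lam j * ℓ j ≤ m j + n j) ∨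
      (∃ a, a < j ∧ ∃ b, b < j ∧ lam j = lam a + lam b - 3 * lam a * lam b ∧ ℓ j = ℓ a + ℓ b ∧
        m j = (1 - lam a) * m b + (1 - lam b) * m a ∧
        n j = (1 - lam a) * n b + (1 - lam b) * n a +
          (1 - 2 * lam a) * lam b * (ℓ a + Real.log (1 - 2 * lam a)) +
          (1 - 2 * lam b) * lam a * (ℓ b + Real.log (1 - 2 * lam b))) := by
    intro j
    cases j with
    | zero =>
      left
      refine ⟨le_rfl, hlam0, le_rfl, hm₀, hn₀, ?_, ?_⟩
      · simp only [hlam, hℓ, hm]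
        rw [hΦ, div_mul_cancel₀ _ hD.ne']
      · have hle : u₀ ≤ (M 0 / r 0 + N 0 / r 0) / ((L 0 : ℝ) / r 0 * Real.log (r 0 : ℝ)) := by
          rw [hu₀]; exact min_le_left _ _
        rw [le_div_iff₀ (mul_pos hl₀ hℓ₀pos)] at hle
        simp only [hlam, hℓ, hm, hn]
        linarith
    | succ j =>
      right
      simp only [hlam, hℓ, hm, hn]
      have hrj : (0 : ℝ) < r j := by linarith [hrpos j]
      have hQpos : (0 : ℝ) < Q j := by have := hQ1 j; exact_mod_cast this
      have er : (r (j + 1) : ℝ) = (r j : ℝ) ^ 2 := by rw [hr j]; push_cast; ring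
      have eQ : (1 : ℝ) - 2 * ((L j : ℝ) / r j) = (Q j : ℝ) / r j := by
        rw [hQ j]; field_simp
      have elogQ : Real.log (r j : ℝ) + Real.log ((Q j : ℝ) / r j) = Real.log (Q j : ℝ) := by
        rw [Real.log_div hQpos.ne' hrj.ne']; ring
      refine ⟨j, Nat.lt_succ_self j, j, Nat.lt_succ_self j, ?_, ?_, ?_, ?_⟩
      · rw [er, legs_real Q L hL j, hQ j]
        field_simp
        ring
      · rw [er, Real.log_pow]
        push_cast
        ring
      · rw [er, hM j, hQ j]
        field_simp
        ring
      · rw [eQ, elogQ, er, hN j, hQ j]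
        field_simp
        ring
  refine ⟨Real.log 3 / 3 * (u₀ * ((L 0 : ℝ) / r 0)) ^ (κ * p) / Φ ^ p,
    div_pos (by positivity) (Real.rpow_pos_of_pos hΦpos p), fun j => ?_⟩
  have hc := anchorTax_certificate lam ℓ m n hκ0 hκ1 hp h23 hΦpos hu₀pos hl₀ hℓ₀pos hℓ₀ H j
  obtain ⟨-, -, -, h3, -, -, -⟩ :=
    schedule_invariant lam ℓ m n hκ0 hκ1 hp h23 hΦpos.le hu₀pos.le hl₀ hℓ₀pos hℓ₀ H j
  simp only [hlam, hm, hn] at hc h3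
  have hrj : (0 : ℝ) < r j := by linarith [hrpos j]
  have hMpos : 0 < M j := by
    have := mul_pos h3 hrj
    rwa [div_mul_cancel₀ _ hrj.ne'] at this
  have e1 : (L j : ℝ) / r j * Real.log (1 / ((L j : ℝ) / r j)) / (M j / r j) =
      (L j : ℝ) * Real.log ((r j : ℝ) / L j) / M j := by
    rw [one_div_div]
    field_simp
  have e2 : N j / r j / (M j / r j) = N j / M j := by field_simp
  rw [hθ, ← e1, ← e2]
  exact hc

end Summit.MatrixMultiplication.MatrixMultiplication.Theorems.FarEdgeDescentAnchorTaxTower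

end
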